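import Literature.Probability.RandomPlanarGeometry.LoewnerCotArgExit
import Literature.Probability.RandomPlanarGeometry.LoewnerScaling
import HarnessLib

/-!
# The centred Loewner flow of a point: translation and scaling covariance, and the cocycle at a fixed time

Topic `Probability/RandomPlanarGeometry`; theorems and two auxiliary definitions, all deterministic
(a continuous driving function `W : ℝ≥0 → ℝ`, a point `z` of the open upper half-plane). For
Rohde–Schramm's centred flow `zₜ = gₜ(z) - Wₜ`, slope `wₜ = Re zₜ / Im zₜ` and ratio
`ψₜ(z) = (Im z)|gₜ'(z)|/Im gₜ(z)` (*Basic properties of SLE*, Ann. of Math. 161 (2005), proof of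
Lemma 6.3, p. 904; `Loewner.centredMap`, `Loewner.cotArg`, `Loewner.derivRatio`) we prove:

* **translation covariance** (`deriv_map_add_const`, `derivRatio_add_const`,
  `centredMap_add_const`, `cotArg_add_const`): translating the driving function and the starting
  point by the same real number does not change `gₜ'`, `ψₜ`, `zₜ`, `wₜ` (Lawler (2005), Ch. 4 §4.1);
* **Brownian scaling covariance** (`deriv_map_scale`, `derivRatio_scale`, `centredMap_scale`,
  `cotArg_scale`): for the rescaled driving function `S_c W = (s ↦ c W(s/c²))`,
  `(g^{S_c W}_t)'(cz) = (g^W_{t/c²})'(z)`, `ψ^{S_c W}_t(cz) = ψ^W_{t/c²}(z)` (Lawler (2005), Ch. 4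
  §4.1, scaling rule; Rohde–Schramm (2005), §3 "by scale invariance");
* the **normalisation to the point `i`** (`normDriving`, `exists_reach_iff_normDriving`): the
  event "`ψₜ(z)` reaches the level `Λ` before the swallowing time `T_z`" for the driving function
  `V` coincides with the same event at the point `i` for the normalised driving function
  `s ↦ (V((Im z)² s) - Re z)/Im z`;
* the **cocycle at a fixed time `r < T_z`** (`incrDriving W r = W(r + ·) - W(r)`,
  `swallowingTime_eq_add_incr`, `centredMap_add_eq_incr`, `cotArg_add_eq_incr`,
  `deriv_map_add_eq_incr`, `derivRatio_add_eq_incr`, `exists_reach_mul_iff_incr`): restarting the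
  flow at time `r` from the current position `z_r` and driving it by the increments of `W` after
  `r` reproduces the flow after `r`:
  `T_z = r + T'_{z_r}`, `z_{r+u} = z'_u`, `w_{r+u} = w'_u`, `g'_{r+u}(z) = (g'_u)'(z_r) g_r'(z)`,
  `ψ_{r+u}(z) = ψ_r(z) ψ'_u(z_r)`. This is the deterministic half of the domain Markov property of
  SLE read on the point functionals (Lawler (2005), Rem. 4.9: `g_{s+t} = g_{s,s+t} ∘ g_s`;
  Rohde–Schramm (2005), p. 911), built on the tree's `Loewner.map_add`,
  `Loewner.coe_add_lt_swallowingTime` and translation covariance.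

## References

* G. F. Lawler, *Conformally Invariant Processes in the Plane*, AMS (2005), Ch. 4 §4.1
  (translation and scaling rules), Rem. 4.9 (the cocycle `g_{s+t} = g_{s,s+t} ∘ g_s`).
* S. Rohde, O. Schramm, *Basic properties of SLE*, Ann. of Math. 161 (2005), proof of Lemma 6.3
  (p. 904), §7 p. 911.
-/

noncomputable section

open Set Filter Topology Complex
open UpperHalfPlane (upperHalfPlaneSet isOpen_upperHalfPlaneSet)
open scoped NNReal

namespace Literature.Probability.RandomPlanarGeometry

namespace Loewner

variable {W V : ℝ≥0 → ℝ} {z : ℂ}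

/-! ### Derivative of the Loewner map at a point of its domain -/

/-- For `t < T_z` and `z ∈ ℍ`, `gₜ` has derivative `deriv gₜ z` at `z` (it is holomorphic on the open
set `Hₜ`, `differentiableOn_map`, `isOpen_domain`). [cite: Lawler2005, Ch. 4 §4.1] -/
theorem hasDerivAt_map_deriv (hW : Continuous W) (hz : 0 < z.im) {t : ℝ≥0}
    (ht : (t : WithTop ℝ≥0) < swallowingTime W z) :
    HasDerivAt (map W t) (deriv (map W t) z) z := by
  have hzd : z ∈ domain W t := (mem_domain_iff W t z).2 ⟨hz, ht⟩
  exact ((differentiableOn_map hW t).differentiableAt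
    ((isOpen_domain hW t).mem_nhds hzd)).hasDerivAt

/-- The points of `Hₜ` near `z ∈ Hₜ` form a neighbourhood of `z`. [folklore] -/
theorem eventually_mem_domain (hW : Continuous W) (hz : 0 < z.im) {t : ℝ≥0}
    (ht : (t : WithTop ℝ≥0) < swallowingTime W z) : ∀ᶠ ζ in 𝓝 z, ζ ∈ domain W t :=
  (isOpen_domain hW t).mem_nhds ((mem_domain_iff W t z).2 ⟨hz, ht⟩)

/-! ### Translation covariance -/

section Translation

/-- Loewner maps of a translated driving function are conjugated by the translation (a copy of the
tree's `map_add_const` of `LoewnerSemigroup`, from `IsSolution.add_const`, kept here to keep the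
imports light). [cite: Lawler2005, Ch. 4 §4.1] -/
theorem map_add_const' (hW : Continuous W) (a : ℝ) {t : ℝ≥0}
    (hz : (t : WithTop ℝ≥0) < swallowingTime W z) :
    map (fun u ↦ W u + a) t (z + a) = map W t z + a := by
  have hz0 : z ≠ W 0 := ne_driving_of_lt_swallowingTime hz
  obtain ⟨g, hg⟩ := exists_isSolution_swallowingTime_holds hW hz0
  have hg' := hg.add_const a
  have hW' : Continuous fun s ↦ W s + a := hW.add continuous_const
  rw [map_eq_of_isSolution hW hg hz, map_eq_of_isSolution hW' hg' hz]

/-- **Translation covariance of `gₜ'`**: `(g^{W+a}_t)'(z + a) = (g^W_t)'(z)` for `t < T_z`, `z ∈ ℍ`.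
[cite: Lawler2005, Ch. 4 §4.1] -/
theorem deriv_map_add_const (hW : Continuous W) (hz : 0 < z.im) (a : ℝ) {t : ℝ≥0}
    (ht : (t : WithTop ℝ≥0) < swallowingTime W z) :
    deriv (map (fun u ↦ W u + a) t) (z + a) = deriv (map W t) z := by
  -- `ζ ↦ g^{W+a}_t (ζ + a)` agrees with `ζ ↦ g_t ζ + a` near `z`
  have hev : (fun ζ ↦ map (fun u ↦ W u + a) t (ζ + a)) =ᶠ[𝓝 z] fun ζ ↦ map W t ζ + a := by
    filter_upwards [eventually_mem_domain hW hz ht] with ζ hζ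
    exact map_add_const' hW a ((mem_domain_iff W t ζ).1 hζ).2
  have h1 : HasDerivAt (fun ζ ↦ map W t ζ + a) (deriv (map W t) z) z :=
    (hasDerivAt_map_deriv hW hz ht).add_const _
  have h2 : HasDerivAt (fun ζ ↦ map (fun u ↦ W u + a) t (ζ + a)) (deriv (map W t) z) z :=
    h1.congr_of_eventuallyEq hev
  -- compose with `ξ ↦ ξ - a`
  have h3 : HasDerivAt (fun ξ : ℂ ↦ ξ - a) 1 (z + a) := (hasDerivAt_id _).sub_const _
  have h4 : HasDerivAt ((fun ζ ↦ map (fun u ↦ W u + a) t (ζ + a)) ∘ fun ξ : ℂ ↦ ξ - a)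
      (deriv (map W t) z * 1) (z + a) := by
    refine HasDerivAt.comp _ ?_ h3
    rw [add_sub_cancel_right]
    exact h2
  have heq : ((fun ζ ↦ map (fun u ↦ W u + a) t (ζ + a)) ∘ fun ξ : ℂ ↦ ξ - a) =
      map (fun u ↦ W u + a) t := by
    funext ξ
    simp
  rw [heq, mul_one] at h4
  exact h4.deriv

/-- Translation covariance of the centred flow: `z_t` is unchanged. [cite: Lawler2005, Ch. 4 §4.1] -/
theorem centredMap_add_const (hW : Continuous W) (a : ℝ) {t : ℝ≥0}
    (ht : (t : WithTop ℝ≥0) < swallowingTime W z) :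
    centredMap (fun u ↦ W u + a) t (z + a) = centredMap W t z := by
  rw [centredMap_apply, centredMap_apply, map_add_const' hW a ht]
  push_cast
  ring

/-- Translation covariance of the slope `w_t`. [cite: Lawler2005, Ch. 4 §4.1] -/
theorem cotArg_add_const (hW : Continuous W) (a : ℝ) {t : ℝ≥0}
    (ht : (t : WithTop ℝ≥0) < swallowingTime W z) :
    cotArg (fun u ↦ W u + a) (z + a) t = cotArg W z t := by
  rw [cotArg_apply, cotArg_apply, centredMap_add_const hW a ht]

/-- **Translation covariance of Rohde–Schramm's ratio**: `ψ^{W+a}_t(z + a) = ψ^W_t(z)`.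
[cite: RohdeSchramm2005, Lemma 6.3] -/
theorem derivRatio_add_const (hW : Continuous W) (hz : 0 < z.im) (a : ℝ) {t : ℝ≥0}
    (ht : (t : WithTop ℝ≥0) < swallowingTime W z) :
    derivRatio (fun u ↦ W u + a) (z + a) t = derivRatio W z t := by
  rw [derivRatio_apply, derivRatio_apply, deriv_map_add_const hW hz a ht, map_add_const' hW a ht]
  simp

end Translation

/-! ### Scaling covariance -/

section Scaling

variable {c : ℝ≥0}

/-- **Scaling covariance of `gₜ'`**: `(g^{S_c W}_t)'(c z) = (g^W_{t/c²})'(z)` for `z ∈ H_{t/c²}`,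
`c > 0` (chain rule in `map_scale`). [cite: Lawler2005, Ch. 4 §4.1] -/
theorem deriv_map_scale (hW : Continuous W) (hc : c ≠ 0) {t : ℝ≥0} (hz : 0 < z.im)
    (ht : ((t / c ^ 2 : ℝ≥0) : WithTop ℝ≥0) < swallowingTime W z) :
    deriv (map (fun s ↦ (c : ℝ) * W (s / c ^ 2)) t) (((c : ℝ) : ℂ) * z) =
      deriv (map W (t / c ^ 2)) z := by
  have hc' : (0 : ℝ) < c := NNReal.coe_pos.2 (pos_iff_ne_zero.2 hc)
  have hcc : ((c : ℝ) : ℂ) ≠ 0 := by exact_mod_cast hc'.ne'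
  set G := map (fun s ↦ (c : ℝ) * W (s / c ^ 2)) t with hG
  -- near `z`, `G (c ζ) = c g_{t/c²}(ζ)`
  have hev : (fun ζ ↦ G (((c : ℝ) : ℂ) * ζ)) =ᶠ[𝓝 z]
      fun ζ ↦ ((c : ℝ) : ℂ) * map W (t / c ^ 2) ζ := by
    filter_upwards [eventually_mem_domain hW hz ht] with ζ hζ
    exact map_scale hW hc hζ
  have h1 : HasDerivAt (fun ζ ↦ ((c : ℝ) : ℂ) * map W (t / c ^ 2) ζ)
      (((c : ℝ) : ℂ) * deriv (map W (t / c ^ 2)) z) z :=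
    (hasDerivAt_map_deriv hW hz ht).const_mul _
  have h2 : HasDerivAt (fun ζ ↦ G (((c : ℝ) : ℂ) * ζ))
      (((c : ℝ) : ℂ) * deriv (map W (t / c ^ 2)) z) z := h1.congr_of_eventuallyEq hev
  have h3 : HasDerivAt (fun ξ : ℂ ↦ ξ / ((c : ℝ) : ℂ)) (1 / ((c : ℝ) : ℂ)) (((c : ℝ) : ℂ) * z) := by
    simpa using (hasDerivAt_id (((c : ℝ) : ℂ) * z)).div_const ((c : ℝ) : ℂ)
  have h4 : HasDerivAt ((fun ζ ↦ G (((c : ℝ) : ℂ) * ζ)) ∘ fun ξ : ℂ ↦ ξ / ((c : ℝ) : ℂ))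
      (((c : ℝ) : ℂ) * deriv (map W (t / c ^ 2)) z * (1 / ((c : ℝ) : ℂ))) (((c : ℝ) : ℂ) * z) := by
    refine HasDerivAt.comp _ ?_ h3
    rw [mul_div_cancel_left₀ z hcc]
    exact h2
  have heq : ((fun ζ ↦ G (((c : ℝ) : ℂ) * ζ)) ∘ fun ξ : ℂ ↦ ξ / ((c : ℝ) : ℂ)) = G := by
    funext ξ
    simp [mul_div_cancel₀ _ hcc]
  rw [heq] at h4
  rw [h4.deriv]
  field_simp

/-- Scaling covariance of the centred flow: `z^{S_c W}_t(cz) = c z^W_{t/c²}(z)`.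
[cite: Lawler2005, Ch. 4 §4.1] -/
theorem centredMap_scale (hW : Continuous W) (hc : c ≠ 0) {t : ℝ≥0} (hz : 0 < z.im)
    (ht : ((t / c ^ 2 : ℝ≥0) : WithTop ℝ≥0) < swallowingTime W z) :
    centredMap (fun s ↦ (c : ℝ) * W (s / c ^ 2)) t (((c : ℝ) : ℂ) * z) =
      ((c : ℝ) : ℂ) * centredMap W (t / c ^ 2) z := by
  have hzd : z ∈ domain W (t / c ^ 2) := (mem_domain_iff W _ z).2 ⟨hz, ht⟩
  rw [centredMap_apply, centredMap_apply, map_scale hW hc hzd]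
  push_cast
  ring

/-- Scaling covariance of the slope: `w^{S_c W}_t(cz) = w^W_{t/c²}(z)`. [cite: Lawler2005, Ch. 4 §4.1] -/
theorem cotArg_scale (hW : Continuous W) (hc : c ≠ 0) {t : ℝ≥0} (hz : 0 < z.im)
    (ht : ((t / c ^ 2 : ℝ≥0) : WithTop ℝ≥0) < swallowingTime W z) :
    cotArg (fun s ↦ (c : ℝ) * W (s / c ^ 2)) (((c : ℝ) : ℂ) * z) t = cotArg W z (t / c ^ 2) := by
  have hc' : (0 : ℝ) < c := NNReal.coe_pos.2 (pos_iff_ne_zero.2 hc)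
  rw [cotArg_apply, cotArg_apply, centredMap_scale hW hc hz ht, Complex.re_ofReal_mul,
    Complex.im_ofReal_mul, mul_div_mul_left _ _ hc'.ne']

/-- **Scaling covariance of Rohde–Schramm's ratio**: `ψ^{S_c W}_t(cz) = ψ^W_{t/c²}(z)`
(Rohde–Schramm (2005), §3: "by scale invariance"). [cite: RohdeSchramm2005, Lemma 6.3] -/
theorem derivRatio_scale (hW : Continuous W) (hc : c ≠ 0) {t : ℝ≥0} (hz : 0 < z.im)
    (ht : ((t / c ^ 2 : ℝ≥0) : WithTop ℝ≥0) < swallowingTime W z) :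
    derivRatio (fun s ↦ (c : ℝ) * W (s / c ^ 2)) (((c : ℝ) : ℂ) * z) t =
      derivRatio W z (t / c ^ 2) := by
  have hc' : (0 : ℝ) < c := NNReal.coe_pos.2 (pos_iff_ne_zero.2 hc)
  have hzd : z ∈ domain W (t / c ^ 2) := (mem_domain_iff W _ z).2 ⟨hz, ht⟩
  rw [derivRatio_apply, derivRatio_apply, deriv_map_scale hW hc hz ht, map_scale hW hc hzd,
    Complex.im_ofReal_mul, Complex.im_ofReal_mul, mul_assoc, mul_div_mul_left _ _ hc'.ne']

end Scaling

/-! ### Normalisation of the starting point to `i` -/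

section Normalise

/-- **The normalised driving function** seen from the point `z ∈ ℍ`:
`normDriving z V s = (V((Im z)² s) - Re z)/Im z`, so that `V - Re z = S_{Im z}(normDriving z V)`
(`S_c U = (s ↦ c U(s/c²))`); the flow of `z` under `V` is the image under `ζ ↦ Re z + (Im z) ζ`
and the time change `s ↦ (Im z)² s` of the flow of `i` under `normDriving z V`. [folklore] -/
def normDriving (z : ℂ) (V : ℝ≥0 → ℝ) (s : ℝ≥0) : ℝ :=
  (V (z.im.toNNReal ^ 2 * s) - z.re) / z.im

/-- Unfolding lemma. [folklore] -/
theorem normDriving_apply (z : ℂ) (V : ℝ≥0 → ℝ) (s : ℝ≥0) :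
    normDriving z V s = (V (z.im.toNNReal ^ 2 * s) - z.re) / z.im := rfl

/-- The normalised driving function is continuous if `V` is. [folklore] -/
theorem continuous_normDriving (z : ℂ) (hV : Continuous V) : Continuous (normDriving z V) :=
  ((hV.comp (continuous_const.mul continuous_id)).sub continuous_const).div_const _

/-- `Im z` as an element of `ℝ≥0` is non-zero for `z ∈ ℍ`. [folklore] -/
theorem toNNReal_im_ne_zero (hz : 0 < z.im) : z.im.toNNReal ≠ 0 := by
  rw [← NNReal.coe_ne_zero, Real.coe_toNNReal _ hz.le]
  exact hz.ne'

/-- Rescaling the normalised driving function by `c = Im z` gives back `V - Re z`. [folklore] -/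
theorem scale_normDriving (hz : 0 < z.im) (V : ℝ≥0 → ℝ) :
    (fun s ↦ (z.im.toNNReal : ℝ) * normDriving z V (s / z.im.toNNReal ^ 2)) =
      fun s ↦ V s + (-z.re) := by
  have hb : (z.im.toNNReal : ℝ) = z.im := Real.coe_toNNReal _ hz.le
  have hb0 : z.im.toNNReal ≠ 0 := toNNReal_im_ne_zero hz
  funext s
  rw [normDriving_apply, hb, mul_div_cancel₀ _ (pow_ne_zero 2 hb0), mul_div_cancel₀ _ hz.ne']
  ring

/-- `(Im z) · i = z + (-Re z)` as complex numbers. [folklore] -/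
theorem toNNReal_im_mul_I (hz : 0 < z.im) :
    (((z.im.toNNReal : ℝ)) : ℂ) * I = z + ((-z.re : ℝ) : ℂ) := by
  rw [Real.coe_toNNReal _ hz.le]
  apply Complex.ext <;> simp

/-- **Normalisation to `i`**: the swallowing time of `z` under `V` is `(Im z)²` times that of `i`
under the normalised driving function. [cite: Lawler2005, Ch. 4 §4.1] -/
theorem swallowingTime_eq_normDriving (hz : 0 < z.im) (V : ℝ≥0 → ℝ) :
    swallowingTime V z =
      ((z.im.toNNReal ^ 2 : ℝ≥0) : WithTop ℝ≥0) * swallowingTime (normDriving z V) I := by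
  have hb0 : z.im.toNNReal ≠ 0 := toNNReal_im_ne_zero hz
  have h1 := swallowingTime_scale hb0 (normDriving z V) I
  rw [scale_normDriving hz V] at h1
  have h2 : ((z.im.toNNReal : ℂ)) * I = z + ((-z.re : ℝ) : ℂ) := toNNReal_im_mul_I hz
  rw [h2, swallowingTime_add_const] at h1
  exact h1

/-- Time change of the normalisation: `t/(Im z)² < T'_i ↔ t < T_z`. [folklore] -/
theorem coe_div_lt_swallowingTime_normDriving_iff (hz : 0 < z.im) (V : ℝ≥0 → ℝ) (t : ℝ≥0) :
    ((t / z.im.toNNReal ^ 2 : ℝ≥0) : WithTop ℝ≥0) < swallowingTime (normDriving z V) I ↔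
      (t : WithTop ℝ≥0) < swallowingTime V z := by
  rw [coe_div_lt_iff_lt_mul (pow_ne_zero 2 (toNNReal_im_ne_zero hz)),
    ← swallowingTime_eq_normDriving hz V]

/-- **Normalisation to `i`, the ratio**: `ψ^V_t(z) = ψ^{normDriving z V}_{t/(Im z)²}(i)` for
`t < T_z`. [cite: RohdeSchramm2005, Lemma 6.3] -/
theorem derivRatio_eq_normDriving (hV : Continuous V) (hz : 0 < z.im) {t : ℝ≥0}
    (ht : (t : WithTop ℝ≥0) < swallowingTime V z) :
    derivRatio V z t = derivRatio (normDriving z V) I (t / z.im.toNNReal ^ 2) := by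
  have hb0 : z.im.toNNReal ≠ 0 := toNNReal_im_ne_zero hz
  have hVn : Continuous (normDriving z V) := continuous_normDriving z hV
  have ht' := (coe_div_lt_swallowingTime_normDriving_iff hz V t).2 ht
  have h1 := derivRatio_scale hVn hb0 (z := I) (t := t) (by simp) ht'
  rw [scale_normDriving hz V, toNNReal_im_mul_I hz] at h1
  rw [← h1, derivRatio_add_const hV hz (-z.re) ht]

/-- **The event "`ψ` reaches `Λ` before the swallowing time" is invariant under the
normalisation to `i`.** [cite: RohdeSchramm2005, Lemma 6.3] -/
theorem exists_reach_iff_normDriving (hV : Continuous V) (hz : 0 < z.im) (lam : ℝ) :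
    (∃ t : ℝ≥0, (t : WithTop ℝ≥0) < swallowingTime V z ∧ lam ≤ derivRatio V z t) ↔
      ∃ t : ℝ≥0, (t : WithTop ℝ≥0) < swallowingTime (normDriving z V) I ∧
        lam ≤ derivRatio (normDriving z V) I t := by
  have hb0 : z.im.toNNReal ≠ 0 := toNNReal_im_ne_zero hz
  constructor
  · rintro ⟨t, ht, hle⟩
    refine ⟨t / z.im.toNNReal ^ 2, (coe_div_lt_swallowingTime_normDriving_iff hz V t).2 ht, ?_⟩
    rwa [← derivRatio_eq_normDriving hV hz ht]
  · rintro ⟨t, ht, hle⟩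
    have ht2 : (((z.im.toNNReal ^ 2 * t : ℝ≥0)) : WithTop ℝ≥0) < swallowingTime V z := by
      rw [← coe_div_lt_swallowingTime_normDriving_iff hz V,
        mul_div_cancel_left₀ _ (pow_ne_zero 2 hb0)]
      exact ht
    refine ⟨z.im.toNNReal ^ 2 * t, ht2, ?_⟩
    rwa [derivRatio_eq_normDriving hV hz ht2, mul_div_cancel_left₀ _ (pow_ne_zero 2 hb0)]

end Normalise

/-! ### The cocycle at a fixed time -/

section Cocycle

variable (W) in
/-- **The increments of the driving function after time `r`**: `incrDriving W r u = W(r + u) - W(r)`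
(for `W = √κ B` and a stopping time in place of `r`, a new Brownian motion by the strong Markov
property). [cite: Lawler2005, Rem. 4.9] -/
def incrDriving (r : ℝ≥0) (u : ℝ≥0) : ℝ := W (r + u) - W r

/-- Unfolding lemma. [folklore] -/
theorem incrDriving_apply (W : ℝ≥0 → ℝ) (r u : ℝ≥0) : incrDriving W r u = W (r + u) - W r := rfl

/-- The increment process starts at `0`. [folklore] -/
@[simp] theorem incrDriving_zero (W : ℝ≥0 → ℝ) (r : ℝ≥0) : incrDriving W r 0 = 0 := by
  simp [incrDriving_apply]

/-- The increments are `W(r + ·)` translated by `-W(r)`. [folklore] -/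
theorem incrDriving_eq (W : ℝ≥0 → ℝ) (r : ℝ≥0) :
    incrDriving W r = fun u ↦ W (r + u) + (-W r) := by
  funext u; rw [incrDriving_apply]; ring

/-- The increment process is continuous if `W` is. [folklore] -/
theorem continuous_incrDriving (hW : Continuous W) (r : ℝ≥0) : Continuous (incrDriving W r) :=
  (hW.comp (continuous_const.add continuous_id)).sub continuous_const

/-- The swallowing time of `z_r` under the increments is that of `g_r(z)` under `W(r + ·)`
(translation covariance). [folklore] -/
theorem swallowingTime_incrDriving_centredMap (W : ℝ≥0 → ℝ) (r : ℝ≥0) (z : ℂ) :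
    swallowingTime (incrDriving W r) (centredMap W r z) =
      swallowingTime (fun u ↦ W (r + u)) (map W r z) := by
  rw [incrDriving_eq, centredMap_apply, sub_eq_add_neg, ← Complex.ofReal_neg]
  exact swallowingTime_add_const (fun u ↦ W (r + u)) (map W r z) (-W r)

/-- For `r < T_z` and `z ∈ ℍ`: `r + u < T_z ↔ u < T'`, `T'` the swallowing time of `z_r` under the
increments after `r` (`map_add`, `coe_add_lt_swallowingTime`, translation covariance).
[cite: Lawler2005, Rem. 4.9] -/
theorem coe_add_lt_swallowingTime_iff_incr (hW : Continuous W) (hz : 0 < z.im) {r : ℝ≥0}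
    (hr : (r : WithTop ℝ≥0) < swallowingTime W z) (u : ℝ≥0) :
    ((r + u : ℝ≥0) : WithTop ℝ≥0) < swallowingTime W z ↔
      (u : WithTop ℝ≥0) < swallowingTime (incrDriving W r) (centredMap W r z) := by
  have hzr : z ∈ domain W r := (mem_domain_iff W r z).2 ⟨hz, hr⟩
  rw [swallowingTime_incrDriving_centredMap]
  exact ⟨fun h ↦ (map_add hW h).1, fun h ↦ coe_add_lt_swallowingTime hW hzr h⟩

/-- **The cocycle for swallowing times**: `T_z = r + T'_{z_r}` for `r < T_z`, where `T'` is the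
swallowing time of `z_r = g_r(z) - W(r)` under the increments of `W` after `r`.
[cite: Lawler2005, Rem. 4.9] -/
theorem swallowingTime_eq_add_incr (hW : Continuous W) (hz : 0 < z.im) {r : ℝ≥0}
    (hr : (r : WithTop ℝ≥0) < swallowingTime W z) :
    swallowingTime W z =
      (r : WithTop ℝ≥0) + swallowingTime (incrDriving W r) (centredMap W r z) := by
  have hiff := coe_add_lt_swallowingTime_iff_incr hW hz hr
  rcases eq_top_or_lt_top (swallowingTime (incrDriving W r) (centredMap W r z)) with hT' | hT'
  · -- `T' = ∞`: then `r + u < T_z` for every `u`, so `T_z = ∞`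
    rw [hT', WithTop.add_top]
    by_contra hne
    obtain ⟨T, hT⟩ := WithTop.ne_top_iff_exists.1 hne
    have h := (hiff T).2 (by rw [hT']; exact WithTop.coe_lt_top T)
    rw [← hT, WithTop.coe_lt_coe] at h
    exact absurd h (not_lt.2 le_add_self)
  · obtain ⟨b, hb⟩ := WithTop.ne_top_iff_exists.1 hT'.ne
    rw [← hb] at hiff ⊢
    have hτ : swallowingTime W z ≠ ⊤ := by
      intro htop
      have h := (hiff b).1 (by rw [htop]; exact WithTop.coe_lt_top _)
      exact lt_irrefl _ (WithTop.coe_lt_coe.1 h)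
    obtain ⟨T, hT⟩ := WithTop.ne_top_iff_exists.1 hτ
    rw [← hT] at hiff hr ⊢
    rw [← WithTop.coe_add, WithTop.coe_inj]
    have hrT : r < T := WithTop.coe_lt_coe.1 hr
    refine le_antisymm ?_ ?_
    · by_contra hlt
      rw [not_le] at hlt
      have h := (hiff b).1 (WithTop.coe_lt_coe.2 hlt)
      exact lt_irrefl _ (WithTop.coe_lt_coe.1 h)
    · by_contra hlt
      rw [not_le] at hlt
      have hu : r + (T - r) = T := add_tsub_cancel_of_le hrT.le
      have h1 : ¬ ((r + (T - r) : ℝ≥0) : WithTop ℝ≥0) < (T : WithTop ℝ≥0) := by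
        rw [hu]; exact lt_irrefl _
      have h2 : ¬ ((T - r : ℝ≥0) : WithTop ℝ≥0) < (b : WithTop ℝ≥0) := fun h ↦ h1 ((hiff _).2 h)
      rw [WithTop.coe_lt_coe, not_lt] at h2
      have : r + b ≤ T := by
        calc r + b ≤ r + (T - r) := by gcongr
          _ = T := hu
      exact absurd hlt (not_lt.2 this)

/-- **The cocycle for the centred flow**: `z_{r+u} = z'_u`, where `z'` is the centred flow of
`z_r` under the increments of `W` after `r` (`r + u < T_z`). [cite: Lawler2005, Rem. 4.9] -/
theorem centredMap_add_eq_incr (hW : Continuous W) {r u : ℝ≥0}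
    (hru : ((r + u : ℝ≥0) : WithTop ℝ≥0) < swallowingTime W z) :
    centredMap W (r + u) z = centredMap (incrDriving W r) u (centredMap W r z) := by
  obtain ⟨hu, hmap⟩ := map_add hW hru
  have hW' : Continuous fun u ↦ W (r + u) := continuous_shift W hW r
  have htr := map_add_const' hW' (-W r) (z := map W r z) hu
  have h1 : map (incrDriving W r) u (centredMap W r z) =
      map (fun u ↦ W (r + u)) u (map W r z) - W r := by
    rw [incrDriving_eq, centredMap_apply, sub_eq_add_neg, ← Complex.ofReal_neg, htr]
    push_cast
    ring
  rw [centredMap_apply, centredMap_apply, hmap, h1, incrDriving_apply]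
  push_cast
  ring

/-- **The cocycle for the slope**: `w_{r+u} = w'_u`. [cite: Lawler2005, Rem. 4.9] -/
theorem cotArg_add_eq_incr (hW : Continuous W) {r u : ℝ≥0}
    (hru : ((r + u : ℝ≥0) : WithTop ℝ≥0) < swallowingTime W z) :
    cotArg W z (r + u) = cotArg (incrDriving W r) (centredMap W r z) u := by
  rw [cotArg_apply, cotArg_apply, centredMap_add_eq_incr hW hru]

/-- `r ≤ r + u < T_z` gives `r < T_z`. [folklore] -/
theorem coe_lt_swallowingTime_of_add {r u : ℝ≥0}
    (hru : ((r + u : ℝ≥0) : WithTop ℝ≥0) < swallowingTime W z) :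
    (r : WithTop ℝ≥0) < swallowingTime W z :=
  lt_of_le_of_lt (WithTop.coe_le_coe.2 le_self_add) hru

/-- **The cocycle for the derivative**: `g_{r+u}'(z) = (g'_u)'(z_r) · g_r'(z)` (chain rule in
`g_{r+u} = g'_u ∘ (g_r - W(r)) + W(r)` near `z`). [cite: Lawler2005, Rem. 4.9] -/
theorem deriv_map_add_eq_incr (hW : Continuous W) (hz : 0 < z.im) {r u : ℝ≥0}
    (hru : ((r + u : ℝ≥0) : WithTop ℝ≥0) < swallowingTime W z) :
    deriv (map W (r + u)) z =
      deriv (map (incrDriving W r) u) (centredMap W r z) * deriv (map W r) z := by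
  have hr : (r : WithTop ℝ≥0) < swallowingTime W z := coe_lt_swallowingTime_of_add hru
  have hzr : 0 < (centredMap W r z).im := im_centredMap_pos hW hz hr
  have hu := (coe_add_lt_swallowingTime_iff_incr hW hz hr u).1 hru
  have hWi : Continuous (incrDriving W r) := continuous_incrDriving hW r
  have hout : HasDerivAt (map (incrDriving W r) u)
      (deriv (map (incrDriving W r) u) (centredMap W r z)) (centredMap W r z) :=
    hasDerivAt_map_deriv hWi hzr hu
  have hin : HasDerivAt (fun ζ ↦ centredMap W r ζ) (deriv (map W r) z) z :=
    (hasDerivAt_map_deriv hW hz hr).sub_const (W r : ℂ)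
  have hcomp := hout.comp z hin
  -- near `z`: `g_{r+u}(ζ) = g'_u(ζ_r) + W(r)`
  have hev : map W (r + u) =ᶠ[𝓝 z] fun ζ ↦ map (incrDriving W r) u (centredMap W r ζ) + W r := by
    filter_upwards [eventually_mem_domain hW hz hru] with ζ hζ
    have hζ' := (mem_domain_iff W _ ζ).1 hζ
    have h := centredMap_add_eq_incr hW hζ'.2
    rw [centredMap_apply, centredMap_apply _ u, incrDriving_apply] at h
    push_cast at h
    linear_combination h
  have h2 : HasDerivAt (fun ζ ↦ map (incrDriving W r) u (centredMap W r ζ) + W r)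
      (deriv (map (incrDriving W r) u) (centredMap W r z) * deriv (map W r) z) z :=
    hcomp.add_const _
  exact (h2.congr_of_eventuallyEq hev).deriv

/-- **The cocycle for Rohde–Schramm's ratio**: `ψ_{r+u}(z) = ψ_r(z) · ψ'_u(z_r)`, `ψ'` the ratio of
`z_r` under the increments of `W` after `r` (`r + u < T_z`). [cite: RohdeSchramm2005, Lemma 6.3] -/
theorem derivRatio_add_eq_incr (hW : Continuous W) (hz : 0 < z.im) {r u : ℝ≥0}
    (hru : ((r + u : ℝ≥0) : WithTop ℝ≥0) < swallowingTime W z) :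
    derivRatio W z (r + u) =
      derivRatio W z r * derivRatio (incrDriving W r) (centredMap W r z) u := by
  have hr : (r : WithTop ℝ≥0) < swallowingTime W z := coe_lt_swallowingTime_of_add hru
  have him : (map W (r + u) z).im = (map (incrDriving W r) u (centredMap W r z)).im := by
    have h := congrArg Complex.im (centredMap_add_eq_incr hW hru)
    rwa [im_centredMap, im_centredMap] at h
  have hy : (map W r z).im ≠ 0 := by
    have := im_centredMap_pos hW hz hr
    rw [im_centredMap] at this
    exact this.ne'
  rw [derivRatio_apply, derivRatio_apply, derivRatio_apply, deriv_map_add_eq_incr hW hz hru,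
    norm_mul, him, im_centredMap]
  field_simp

/-- **The cocycle for the event "the ratio is multiplied by `Λ` after time `r`"**: for `r < T_z`,
`ψ(z)` reaches `Λ ψ_r(z)` before `T_z` iff the ratio `ψ'` of `z_r` under the increments after `r`
reaches `Λ` before its own swallowing time. [cite: RohdeSchramm2005, Lemma 6.3] -/
theorem exists_reach_mul_iff_incr (hW : Continuous W) (hz : 0 < z.im) {r : ℝ≥0}
    (hr : (r : WithTop ℝ≥0) < swallowingTime W z) (lam : ℝ) :
    (∃ t : ℝ≥0, (t : WithTop ℝ≥0) < swallowingTime W z ∧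
        lam * derivRatio W z r ≤ derivRatio W z t) ↔
      ∃ u : ℝ≥0, (u : WithTop ℝ≥0) < swallowingTime (incrDriving W r) (centredMap W r z) ∧
        lam ≤ derivRatio (incrDriving W r) (centredMap W r z) u := by
  have hzr : 0 < (centredMap W r z).im := im_centredMap_pos hW hz hr
  have hWi : Continuous (incrDriving W r) := continuous_incrDriving hW r
  have h1 : 1 ≤ derivRatio W z r := one_le_derivRatio hW hz hr
  have h0' : (0 : WithTop ℝ≥0) < swallowingTime (incrDriving W r) (centredMap W r z) :=
    swallowingTime_pos_holds hWi (ne_driving_of_im_pos hzr 0)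
  constructor
  · rintro ⟨t, ht, hle⟩
    rcases le_or_gt r t with hrt | hlt
    · obtain ⟨u, rfl⟩ : ∃ u, t = r + u := ⟨t - r, (add_tsub_cancel_of_le hrt).symm⟩
      refine ⟨u, (coe_add_lt_swallowingTime_iff_incr hW hz hr u).1 ht, ?_⟩
      rw [derivRatio_add_eq_incr hW hz ht, mul_comm] at hle
      exact le_of_mul_le_mul_left hle (by linarith)
    · -- `t < r`: then `λ ψ_r ≤ ψ_t ≤ ψ_r`, so `λ ≤ 1 = ψ'_0`
      have hmono := derivRatio_mono hW hz hlt.le hr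
      have hlam : lam ≤ 1 := by
        by_contra h
        rw [not_le] at h
        nlinarith
      refine ⟨0, h0', ?_⟩
      rwa [derivRatio_zero hWi hzr]
  · rintro ⟨u, hu, hle⟩
    have hru := (coe_add_lt_swallowingTime_iff_incr hW hz hr u).2 hu
    refine ⟨r + u, hru, ?_⟩
    rw [derivRatio_add_eq_incr hW hz hru]
    nlinarith

end Cocycle

end Loewner

end Literature.Probability.RandomPlanarGeometry
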